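import Mathlib.Algebra.Polynomial.Roots
import Mathlib.Analysis.SpecialFunctions.Sqrt
import Mathlib.Topology.MetricSpace.Basic
import Mathlib.Topology.Instances.Real.Lemmas
import Mathlib.Tactic.Linarith
import Mathlib.Tactic.FieldSimp
import Mathlib.Tactic.LinearCombination
import HarnessLib

/-!
# FunctionalMining — towards `BurkConcave` (7): finitely many seam events on a line (`‖k‖ < ‖h‖`)

search for candidate a priori estimates; no regularity claim.  Cell `pub-nsfunc`, prove seat gen 7.  Seventh set of bricks for
the DISCHARGE of the typed hypothesis `Laminate.BurkConcave` (Burkholder 1991, LNM 1464, §8): along a line with `q(t) = a + 2bt + ct²`,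
`p(t) = d + 2et + ft²`, `R = √q`, `Z = √p`, the four seams of Burkholder's `u_λ` are `R + Z = 1`, `Z + R = λ − 1`, `Z − R = λ − 1` and
`p − q = λ² − 1`.  Each of the first three implies the QUARTIC identity `(p − q − κ²)² = 4κ²q` (`κ = 1`, resp. `λ − 1`), whose leading
coefficient in `t` is `(f − c)²`; the last is a quadratic with leading coefficient `f − c`.  Hence for `f ≠ c` (strict subordination
`‖k‖ < ‖h‖` gives `f < c`) every seam is met at FINITELY many parameters, and around any `t` there is a punctured neighbourhood free
of seam events — the input of the local gluing (`…ConcaveLocal`, `…ConcaveGlue`, `…ConcaveSeams`).  CONTENT: `Burk.quartic_zeros_finite`,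
`Burk.quadratic_zeros_finite` (via `Polynomial.finite_setOf_isRoot`), `Burk.seam_eq_quartic`, `Burk.seamQuartic_zeros_finite`,
`Burk.levelQuadratic_zeros_finite`, `Burk.exists_nhds_avoid`.  HONEST SIZE: bookkeeping.  Nothing about Navier–Stokes.
-/

noncomputable section

namespace Summit.NavierStokesRegularity.FunctionalMining

namespace Burk

open Set

open Polynomial in
/-- A real quartic with non-zero leading coefficient has finitely many zeros. [ours; bookkeeping] -/
theorem quartic_zeros_finite {α₀ α₁ α₂ α₃ α₄ : ℝ} (h : α₄ ≠ 0) :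
    {t : ℝ | α₀ + α₁ * t + α₂ * t ^ 2 + α₃ * t ^ 3 + α₄ * t ^ 4 = 0}.Finite := by
  obtain ⟨P, hP⟩ : ∃ P : ℝ[X], P = C α₀ + C α₁ * X + C α₂ * X ^ 2 + C α₃ * X ^ 3 + C α₄ * X ^ 4 := ⟨_, rfl⟩
  have hP0 : P ≠ 0 := by
    intro h0
    have hc : P.coeff 4 = α₄ := by
      rw [hP]
      simp [coeff_add, coeff_C_mul, coeff_X_pow]
    rw [h0, coeff_zero] at hc
    exact h hc.symm
  refine (P.finite_setOf_isRoot hP0).subset ?_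
  intro t ht
  simp only [mem_setOf_eq] at ht ⊢
  rw [IsRoot.def, hP]
  simp only [eval_add, eval_mul, eval_C, eval_X, eval_pow]
  exact ht

open Polynomial in
/-- A real quadratic with non-zero leading coefficient has finitely many zeros. [ours; bookkeeping] -/
theorem quadratic_zeros_finite {α₀ α₁ α₂ : ℝ} (h : α₂ ≠ 0) :
    {t : ℝ | α₀ + α₁ * t + α₂ * t ^ 2 = 0}.Finite := by
  obtain ⟨P, hP⟩ : ∃ P : ℝ[X], P = C α₀ + C α₁ * X + C α₂ * X ^ 2 := ⟨_, rfl⟩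
  have hP0 : P ≠ 0 := by
    intro h0
    have hc : P.coeff 2 = α₂ := by
      rw [hP]
      simp [coeff_add, coeff_C_mul, coeff_X_pow]
    rw [h0, coeff_zero] at hc
    exact h hc.symm
  refine (P.finite_setOf_isRoot hP0).subset ?_
  intro t ht
  simp only [mem_setOf_eq] at ht ⊢
  rw [IsRoot.def, hP]
  simp only [eval_add, eval_mul, eval_C, eval_X, eval_pow]
  exact ht

/-- **Seam ⟹ quartic.** If `R² = q`, `Z² = p` and `Z − R = κ` or `Z + R = κ`, then `(p − q − κ²)² − 4κ²q = 0`
(`Z = R ± κ` squared: `p − q − κ² = ±2κR`, squared again).  The seams `R + Z = 1` (`κ = 1`), `Z ± R = λ − 1` (`κ = λ − 1`)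
of Burkholder's `u_λ` are of this form. [ours; elementary] -/
theorem seam_eq_quartic {R Z q p κ : ℝ} (hR : R ^ 2 = q) (hZ : Z ^ 2 = p) (h : Z - R = κ ∨ Z + R = κ) :
    (p - q - κ ^ 2) ^ 2 - 4 * κ ^ 2 * q = 0 := by
  rcases h with h | h
  · have hz : Z = R + κ := by linarith
    rw [← hR, ← hZ, hz]; ring
  · have hz : Z = κ - R := by linarith
    rw [← hR, ← hZ, hz]; ring

/-- **Finitely many seam parameters** (`f ≠ c`): the zero set of `t ↦ (p(t) − q(t) − κ²)² − 4κ²q(t)` is finite — its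
coefficient of `t⁴` is `(f − c)²`. [ours; elementary] -/
theorem seamQuartic_zeros_finite (a b c d e f κ : ℝ) (hfc : f ≠ c) :
    {t : ℝ | ((d + 2 * e * t + f * t ^ 2) - (a + 2 * b * t + c * t ^ 2) - κ ^ 2) ^ 2
      - 4 * κ ^ 2 * (a + 2 * b * t + c * t ^ 2) = 0}.Finite := by
  have h4 : (f - c) ^ 2 ≠ 0 := pow_ne_zero 2 (sub_ne_zero.2 hfc)
  refine (quartic_zeros_finite (α₀ := (d - a - κ ^ 2) ^ 2 - 4 * κ ^ 2 * a)
    (α₁ := 2 * (d - a - κ ^ 2) * (2 * (e - b)) - 8 * κ ^ 2 * b)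
    (α₂ := (2 * (e - b)) ^ 2 + 2 * (d - a - κ ^ 2) * (f - c) - 4 * κ ^ 2 * c)
    (α₃ := 2 * (2 * (e - b)) * (f - c)) h4).subset ?_
  intro t ht
  simp only [mem_setOf_eq] at ht ⊢
  linear_combination ht

/-- **Finitely many level parameters** of `p − q` (`f ≠ c`): the zero set of `t ↦ p(t) − q(t) − ℓ` is finite (the seam
`p − q = λ² − 1` is `ℓ = λ² − 1`; the zeros of `q` itself are the case `p = 0`, `ℓ = 0` with the roles exchanged, see
`quadratic_zeros_finite`). [ours; elementary] -/
theorem levelQuadratic_zeros_finite (a b c d e f ℓ : ℝ) (hfc : f ≠ c) :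
    {t : ℝ | (d + 2 * e * t + f * t ^ 2) - (a + 2 * b * t + c * t ^ 2) - ℓ = 0}.Finite := by
  refine (quadratic_zeros_finite (α₀ := d - a - ℓ) (α₁ := 2 * (e - b)) (sub_ne_zero.2 hfc)).subset ?_
  intro t ht
  simp only [mem_setOf_eq] at ht ⊢
  linear_combination ht

/-- **A punctured neighbourhood free of events.** For a finite `F ⊆ ℝ` and any `t` there is `δ > 0` with no point of `F` in
`(t − δ, t + δ)` other than possibly `t` itself. [ours; bookkeeping] -/
theorem exists_nhds_avoid {F : Set ℝ} (hF : F.Finite) (t : ℝ) :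
    ∃ δ : ℝ, 0 < δ ∧ ∀ s : ℝ, |s - t| < δ → s ≠ t → s ∉ F := by
  have hc : IsClosed (F \ {t}) := (hF.subset fun _ hs => hs.1).isClosed
  have ht : t ∈ (F \ {t})ᶜ := fun h => h.2 rfl
  obtain ⟨δ, hδ, hball⟩ := Metric.isOpen_iff.1 hc.isOpen_compl t ht
  refine ⟨δ, hδ, fun s hs hst hsF => ?_⟩
  have hsb : s ∈ Metric.ball t δ := by
    rw [Metric.mem_ball, Real.dist_eq]; exact hs
  exact hball hsb ⟨hsF, hst⟩

end Burk

end Summit.NavierStokesRegularity.FunctionalMining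

end
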